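import Literature.AlgebraicGeometry.Hironaka2017.EdgeInvAnyField
import Literature.RingTheory.MvPolynomial.BuchbergerCriterion
import Literature.RingTheory.MvPolynomial.WeightMonomialOrder
import HarnessLib

/-!
# Standard monomials of a triangular system of additive forms (Hironaka 1970; Giraud 1975 §1.6 (3)–(4))

Topic: `Literature/AlgebraicGeometry/Resolution`. Let `K` be a field of exponential characteristic `p`,
`S = K[X_1, …, X_n]`, and `U = K[σ_1, …, σ_r] ⊆ S` a subalgebra with a TRIANGULAR presentation
(`Hironaka2017.EdgeAlgebra.TriangularPresentation`, which exists for every graded Hasse–Schmidt-stable `U` over any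
field, `nonempty_triangularPresentation`): `σ_j = X_{ι(j)}^{q_j} + Σ_{k ≠ ι(j)} c_{jk} X_k^{q_j}`, `q_j = p^{e_j}`,
distinct pivots `ι(j)`, echelon form (`σ_j` involves no earlier pivot).

> **Giraud 1975, §1.6 (after Hironaka [8]).** "on considère des polynômes additifs `S_i` qui engendrent `U` et à la
> suite de Hironaka [8], on note que, quitte à changer l'ordre des variables `X_α`, on peut modifier les `S_i` de
> manière à avoir un système triangulaire (3) `S_i = X_i^{q(i)} + Σ_{j>i} S_{ij} X_j^{q(i)}`, `1 ≤ i ≤ e`, … (4)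
> `Z_i = X_i` pour `1 ≤ i ≤ e` et `W_i = X_{i+e}` … On notera `exp(I; Z; W)` l'exposant de l'idéal `I` par
> rapport aux variables `Z_1, …, Z_e, W_1, …, W_{N−e}`, dans cet ordre."
>
> **Cox–Little–O'Shea 2007, Ch. 2 §9 Prop. 4 / Thm. 3; Ch. 5 §3 Prop. 1.** Relatively prime leading monomials give
> S-polynomials reducing to zero, hence a Gröbner basis; the monomials outside `⟨LT(I)⟩` are linearly independent
> modulo `I`.

This file supplies the Gröbner-basis reading of the triangular form that Giraud uses implicitly ("l'exposant …
dans cet ordre"), as kernel-checked lemmas consumed by `RidgeShiftCoefficients.lean` / `RidgeAlgebraDirects.lean`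
(Giraud's theorem (3): `I = (I ∩ U) S`):

* `triWeight`, `triOrder` — the PIVOT WEIGHT ORDER `≺_P` (pivot `ι(j)` weighs `r − j`, non-pivots `0`, ties broken
  lexicographically; the tree's `weightLex`); `toSyn_single_lt` (every other power occurring in `σ_j` is
  `≺_P`-smaller than the pivot power — non-pivot or LATER pivot), **`degree_gen`** (`LM(σ_j) = X_{ι(j)}^{q_j}`),
  **`isGroebnerBasis_range_gen`** (pairwise coprime leading monomials ⇒ Gröbner basis, CLO §9 Prop. 4);
* `IsTriStd P s` (`s_{ι(j)} < q_j` for all `j`: the standard monomials), `eq_zero_of_mem_span_of_forall_isTriStd`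
  (an element of `(σ)` supported on standard monomials is `0`), **`linearIndependent_mk_monomial`** (standard
  monomials are `K`-linearly independent in `S/(σ)`, CLO Ch. 5 §3 Prop. 1 (ii)), **`exists_dual_isTriStd`**
  (dual functionals `ψ_a : S/(σ) → K`, `ψ_a(X^c) = δ_{ac}` on standard `c`);
* `stdSpan`, **`monomial_mem_stdSpan` / `mem_stdSpan` / `exists_expansion`** — division by the pivot powers:
  every `f ∈ S` is a finite sum `Σ_b u_b X^b` over standard `b` with `u_b ∈ U` (well-founded induction on `≺_P`).

(Freeness of `S` over `U` on the standard monomials also holds but is not needed downstream and not proved.)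
Written for the cell res-hironaka (W4.6 rung (iv) support, seat res-L1-s46-pv-7 gen 4). AI-written; AI review is
weaker than expert review.

## References

* J. Giraud, *Contact maximal en caractéristique positive*, Ann. Sci. ÉNS (4) 8 (1975) 201–234, §1.6 (3)–(4)
  p.204. [Giraud1975]
* H. Hironaka, *Additive groups associated with points of a projective space*, Ann. of Math. 92 (1970) 327–334.
  [Hironaka1970AdditiveGroups]
* D. Cox, J. Little, D. O'Shea, *Ideals, Varieties, and Algorithms*, 3rd ed. (2007), Ch. 2 §9 Prop. 4, Thm. 3;
  Ch. 5 §3 Prop. 1. [CoxLittleOShea2007]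
-/

noncomputable section

open MvPolynomial
open scoped MonomialOrder
open Literature.AlgebraicGeometry.Hironaka2017.EdgeAlgebra
open Literature.RingTheory.MvPolynomial
open Literature.RingTheory.MvPolynomial.BuchbergerCriterion

namespace Literature.AlgebraicGeometry.Resolution

universe u

variable {K : Type u} [Field K] {n : ℕ} {p : ℕ}

/-! ## 1. A triangular system of additive forms is a Gröbner basis for a pivot weight order -/

section Groebner

variable {U : Subalgebra K (MvPolynomial (Fin n) K)}

/-- The **pivot weight**: the pivot variable `X_{ι(j)}` of the `j`-th triangular generator weighs `r − j`,
non-pivot variables weigh `0` (so earlier pivots are heavier, and every pivot is heavier than every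
non-pivot). [folklore] -/
def triWeight (P : TriangularPresentation p U) : Fin n → ℕ :=
  fun k => ∑ j : Fin P.r, if P.pivot j = k then P.r - j else 0

/-- The weight of the `j`-th pivot is `r − j`. [folklore] -/
private theorem triWeight_pivot (P : TriangularPresentation p U) (j : Fin P.r) :
    triWeight P (P.pivot j) = P.r - j := by
  unfold triWeight
  rw [Finset.sum_eq_single j]
  · rw [if_pos rfl]
  · intro j' _ hj'
    rw [if_neg fun h => hj' (P.pivot_injective h)]
  · intro h; exact absurd (Finset.mem_univ j) h

/-- Non-pivot variables weigh `0`. [folklore] -/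
private theorem triWeight_of_not_mem (P : TriangularPresentation p U) {k : Fin n} (hk : k ∉ Set.range P.pivot) :
    triWeight P k = 0 := by
  unfold triWeight
  refine Finset.sum_eq_zero fun j _ => ?_
  rw [if_neg fun h => hk ⟨j, h⟩]

/-- The **pivot weight order** `≺_P`: compare pivot weights first, then lexicographically. [folklore] -/
def triOrder (P : TriangularPresentation p U) : MonomialOrder (Fin n) :=
  weightLex (triWeight P) MonomialOrder.lex

/-- The weight of a pure power `X_k^q` is `q · w(k)`. [folklore] -/
private theorem weight_single (w : Fin n → ℕ) (k : Fin n) (q : ℕ) :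
    Finsupp.weight w (Finsupp.single k q) = q * w k := by
  rw [Finsupp.weight_apply, Finsupp.sum_single_index (by simp), smul_eq_mul]

variable [ExpChar K p]

/-- **In `σ_j = X_{ι(j)}^{q_j} + Σ_{k ≠ ι(j)} c_{jk} X_k^{q_j}` every other occurring power is lighter than the
pivot power**: a variable `X_k` with `c_{jk} ≠ 0`, `k ≠ ι(j)`, is a non-pivot or a LATER pivot (echelon form).
[folklore] -/
private theorem toSyn_single_lt (P : TriangularPresentation p U) (j : Fin P.r) {k : Fin n} (hk : k ≠ P.pivot j)
    (hc : P.coef j k ≠ 0) :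
    Finsupp.single k (P.q j) ≺[triOrder P] Finsupp.single (P.pivot j) (P.q j) := by
  rw [triOrder, weightLex_lt_iff]
  left
  rw [weight_single, weight_single, triWeight_pivot]
  have hq : 0 < P.q j := P.one_le_q j
  refine Nat.mul_lt_mul_of_pos_left ?_ hq
  by_cases hkr : k ∈ Set.range P.pivot
  · obtain ⟨j', rfl⟩ := hkr
    rw [triWeight_pivot]
    have hne : j' ≠ j := fun h => hk (by rw [h])
    have hlt : j < j' := by
      rcases lt_or_gt_of_ne hne with h | h
      · exact absurd (P.coef_pivot_eq_zero j j' h) hc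
      · exact h
    have := j'.isLt
    omega
  · rw [triWeight_of_not_mem P hkr]
    have := j.isLt
    omega

/-- `0 ≺ d` for a nonzero exponent. [folklore] -/
private theorem toSyn_zero_lt (m : MonomialOrder (Fin n)) {d : Fin n →₀ ℕ} (hd : d ≠ 0) : (0 : Fin n →₀ ℕ) ≺[m] d := by
  rw [map_zero]
  exact lt_of_le_of_ne bot_le (Ne.symm ((EmbeddingLike.map_ne_zero_iff).mpr hd))

/-- **The leading exponent of the triangular generator `σ_j` is its pivot power `X_{ι(j)}^{q_j}`** (Giraud: the
triangular system read "par rapport aux variables `Z_1, …, Z_e, W_1, …, W_{N−e}`, dans cet ordre").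
[cite: Giraud1975, §1.6 (3)–(4) p.204] -/
theorem degree_gen (P : TriangularPresentation p U) (j : Fin P.r) :
    (triOrder P).degree (P.gen j) = Finsupp.single (P.pivot j) (P.q j) := by
  classical
  -- split off the pivot term
  have hsplit : P.gen j = monomial (Finsupp.single (P.pivot j) (P.q j)) (1 : K) +
      ∑ k ∈ Finset.univ.erase (P.pivot j), C (P.coef j k) * X k ^ P.q j := by
    rw [TriangularPresentation.gen, ← Finset.add_sum_erase _ _ (Finset.mem_univ (P.pivot j)), P.coef_pivot, C_1,
      one_mul, X_pow_eq_monomial]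
    rfl
  have hmon : (triOrder P).degree (monomial (Finsupp.single (P.pivot j) (P.q j)) (1 : K)) =
      Finsupp.single (P.pivot j) (P.q j) := by
    rw [MonomialOrder.degree_monomial, if_neg one_ne_zero]
  rw [hsplit, MonomialOrder.degree_add_of_lt, hmon]
  rw [hmon]
  have hq : Finsupp.single (P.pivot j) (P.q j) ≠ 0 := by
    rw [Ne, Finsupp.single_eq_zero]
    exact Nat.pos_iff_ne_zero.mp (P.one_le_q j)
  rw [MonomialOrder.degree_lt_iff (toSyn_zero_lt _ hq)]
  intro c hc
  obtain ⟨k, hk, hkc⟩ := Finset.mem_biUnion.mp (support_sum hc)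
  have hk' : k ≠ P.pivot j := (Finset.mem_erase.mp hk).1
  have hc0 : P.coef j k ≠ 0 := by
    intro h0
    rw [h0, C_0, zero_mul, support_zero] at hkc
    exact absurd hkc (Finset.notMem_empty c)
  rw [X_pow_eq_monomial, C_mul_monomial, mul_one] at hkc
  obtain rfl : c = Finsupp.single k (P.q j) := by
    have := support_monomial_subset hkc
    rwa [Finset.mem_singleton] at this
  exact toSyn_single_lt P j hk' hc0

/-- **The triangular generators are a Gröbner basis** of the ideal they generate, for the pivot weight order:
their leading monomials `X_{ι(j)}^{q_j}` are pairwise coprime (distinct pivots), so Buchberger's product criterion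
applies. [cite: CoxLittleOShea2007, Ch.2 §9 Prop. 4 and Thm. 3] -/
theorem isGroebnerBasis_range_gen (P : TriangularPresentation p U) :
    IsGroebnerBasis (triOrder P) (Set.range P.gen) (Ideal.span (Set.range P.gen)) := by
  refine (isGroebnerBasis_iff_sPolynomial_reducesToZero_of_ne rfl).2 fun g₁ h₁ g₂ h₂ hne => ?_
  obtain ⟨j₁, rfl⟩ := h₁
  obtain ⟨j₂, rfl⟩ := h₂
  refine reducesToZero_sPolynomial_of_inf_degree_eq_zero ⟨j₁, rfl⟩ ⟨j₂, rfl⟩ ?_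
  rw [degree_gen, degree_gen]
  have hj : P.pivot j₁ ≠ P.pivot j₂ := fun h => hne (by rw [P.pivot_injective h])
  ext k
  simp only [Finsupp.inf_apply, Finsupp.single_apply, Finsupp.coe_zero, Pi.zero_apply]
  split_ifs with ha hb
  · exact absurd (ha.trans hb.symm) hj
  all_goals simp

variable (P : TriangularPresentation p U) in
/-- **Standard exponents** of the triangular system: `s` with `s_{ι(j)} < q_j` for every `j` — the monomials
`X^s` divisible by no leading monomial `X_{ι(j)}^{q_j}`. [cite: CoxLittleOShea2007, Ch.5 §3 Prop. 1] -/
def IsTriStd (s : Fin n →₀ ℕ) : Prop :=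
  ∀ j : Fin P.r, s (P.pivot j) < P.q j

omit [ExpChar K p] in
/-- Standard exponents form a down-set (divisors of standard monomials are standard). [cite: CoxLittleOShea2007, Ch.2 §4 Lemma 2] -/
theorem IsTriStd.of_le {P : TriangularPresentation p U} {s t : Fin n →₀ ℕ} (ht : IsTriStd P t) (h : s ≤ t) :
    IsTriStd P s :=
  fun j => lt_of_le_of_lt (h (P.pivot j)) (ht j)

/-- A polynomial supported on standard monomials is reduced with respect to the triangular generators.
[cite: CoxLittleOShea2007, Ch.2 §6 Prop. 1] -/
private theorem isReduced_of_forall_isTriStd (P : TriangularPresentation p U) {r : MvPolynomial (Fin n) K}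
    (hr : ∀ s ∈ r.support, IsTriStd P s) : IsReduced (triOrder P) (Set.range P.gen) r := by
  rintro s hs _ ⟨j, rfl⟩ - hle
  rw [degree_gen, Finsupp.single_le_iff] at hle
  exact absurd (hr s hs j) (not_lt.mpr hle)

/-- **An element of `(σ_1, …, σ_r)` supported on standard monomials vanishes.** [cite: CoxLittleOShea2007, Ch.5 §3 Prop. 1 (ii)] -/
theorem eq_zero_of_mem_span_of_forall_isTriStd (P : TriangularPresentation p U) {r : MvPolynomial (Fin n) K}
    (hr : ∀ s ∈ r.support, IsTriStd P s) (hmem : r ∈ Ideal.span (Set.range P.gen)) : r = 0 :=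
  (isGroebnerBasis_range_gen P).eq_of_sub_mem (isReduced_of_forall_isTriStd P hr)
    (fun s hs => by simp at hs) (by rwa [sub_zero])

end Groebner

/-! ## 2. Standard monomials are linearly independent modulo `(σ_1, …, σ_r)`; dual functionals -/

section Dual

variable {U : Subalgebra K (MvPolynomial (Fin n) K)} [ExpChar K p]

/-- The ideal `(σ_1, …, σ_r)` of a triangular system (for the ridge: `𝔉` itself, `ridgeIdeal_eq_span_range_gen`).
[folklore] -/
abbrev triIdeal (P : TriangularPresentation p U) : Ideal (MvPolynomial (Fin n) K) :=
  Ideal.span (Set.range P.gen)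

/-- **The standard monomials are `K`-linearly independent in `S/(σ_1, …, σ_r)`** (CLO Ch.5 §3 Prop. 1 (ii) for the
Gröbner basis `σ`). [cite: CoxLittleOShea2007, Ch.5 §3 Prop. 1 (ii)] -/
theorem linearIndependent_mk_monomial (P : TriangularPresentation p U) :
    LinearIndependent K (fun s : {s : Fin n →₀ ℕ // IsTriStd P s} =>
      Ideal.Quotient.mk (triIdeal P) (monomial s.1 (1 : K))) := by
  classical
  rw [linearIndependent_iff']
  intro t g hsum i hi
  -- the relation says `Σ g_s X^s ∈ (σ)`
  set r : MvPolynomial (Fin n) K := ∑ s ∈ t, monomial s.1 (g s) with hr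
  have hrel : Ideal.Quotient.mk (triIdeal P) r = 0 := by
    rw [hr, map_sum, ← hsum]
    refine Finset.sum_congr rfl fun s _ => ?_
    rw [show monomial s.1 (g s) = g s • monomial s.1 (1 : K) by rw [smul_monomial, smul_eq_mul, mul_one],
      ← Ideal.Quotient.mkₐ_eq_mk K, map_smul]
  have hmem : r ∈ triIdeal P := Ideal.Quotient.eq_zero_iff_mem.mp hrel
  -- `r` is supported on standard monomials, hence `r = 0`
  have hsupp : ∀ s ∈ r.support, IsTriStd P s := by
    intro s hs
    obtain ⟨s', -, hs'⟩ := Finset.mem_biUnion.mp (support_sum hs)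
    have := support_monomial_subset hs'
    rw [Finset.mem_singleton] at this
    rw [this]
    exact s'.2
  have hr0 : r = 0 := eq_zero_of_mem_span_of_forall_isTriStd P hsupp hmem
  -- read off the coefficient of `X^i`
  have hcoeff : coeff i.1 r = g i := by
    rw [hr, coeff_sum]
    simp_rw [coeff_monomial]
    rw [Finset.sum_eq_single i]
    · rw [if_pos rfl]
    · intro s _ hs
      rw [if_neg fun h => hs (Subtype.ext h)]
    · intro h; exact absurd hi h
  rw [← hcoeff, hr0, coeff_zero]

/-- **Dual functionals**: for a standard exponent `a` there is a `K`-linear functional `ψ_a` on `S/(σ)` with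
`ψ_a(X^c) = δ_{ac}` on all standard monomials `X^c` (a coordinate functional of the basis of standard monomials of
`Span(x^α : x^α ∉ ⟨LT(I)⟩) ≅ k[x]/I`, extended to `S/(σ)`). [cite: CoxLittleOShea2007, Ch.5 §3 Prop. 4] -/
theorem exists_dual_isTriStd (P : TriangularPresentation p U) {a : Fin n →₀ ℕ} (ha : IsTriStd P a) :
    ∃ ψ : (MvPolynomial (Fin n) K ⧸ triIdeal P) →ₗ[K] K,
      ∀ c, IsTriStd P c → ψ (Ideal.Quotient.mk (triIdeal P) (monomial c 1)) = if c = a then 1 else 0 := by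
  classical
  set v := fun s : {s : Fin n →₀ ℕ // IsTriStd P s} =>
    Ideal.Quotient.mk (triIdeal P) (monomial s.1 (1 : K)) with hv
  have hli : LinearIndependent K v := linearIndependent_mk_monomial P
  set f : Submodule.span K (Set.range v) →ₗ[K] K := (Finsupp.lapply ⟨a, ha⟩) ∘ₗ hli.repr with hf
  obtain ⟨g, hg⟩ := LinearMap.exists_extend f
  refine ⟨g, fun c hc => ?_⟩
  have hmem : v ⟨c, hc⟩ ∈ Submodule.span K (Set.range v) := Submodule.subset_span ⟨⟨c, hc⟩, rfl⟩
  have h1 : g (v ⟨c, hc⟩) = f ⟨v ⟨c, hc⟩, hmem⟩ := by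
    rw [← hg]; rfl
  rw [show Ideal.Quotient.mk (triIdeal P) (monomial c 1) = v ⟨c, hc⟩ from rfl, h1, hf, LinearMap.comp_apply,
    hli.repr_eq_single ⟨c, hc⟩ ⟨v ⟨c, hc⟩, hmem⟩ rfl, Finsupp.lapply_apply, Finsupp.single_apply]
  simp only [Subtype.mk.injEq]

end Dual

/-! ## 6. `S` is spanned over `U = K[σ]` by the standard monomials -/

section Expansion

variable {U : Subalgebra K (MvPolynomial (Fin n) K)}

variable (P : TriangularPresentation p U) in
/-- The `U`-submodule of `S` spanned by the standard monomials (in fact all of `S`, `mem_stdSpan`; and freely so,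
which is not needed here). [folklore] -/
def stdSpan : Submodule U (MvPolynomial (Fin n) K) :=
  Submodule.span U ((fun b => monomial b (1 : K)) '' {b | IsTriStd P b})

/-- `K`-multiples stay in the `U`-span. [folklore] -/
private theorem smul_mem_stdSpan (P : TriangularPresentation p U) (c : K) {f : MvPolynomial (Fin n) K}
    (hf : f ∈ stdSpan P) : c • f ∈ stdSpan P := by
  rw [← algebraMap_smul U c f]
  exact (stdSpan P).smul_mem _ hf

/-- Strict monotonicity of a monomial order under adding a nonzero exponent. [folklore] -/
private theorem toSyn_lt_add (m : MonomialOrder (Fin n)) (t : Fin n →₀ ℕ) {d : Fin n →₀ ℕ} (hd : d ≠ 0) :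
    t ≺[m] t + d := by
  refine lt_of_le_of_ne (m.toSyn_monotone le_self_add) fun h => hd ?_
  have := m.toSyn.injective h
  simpa using this

/-- Translation invariance of a monomial order (strict form). [folklore] -/
private theorem toSyn_add_lt_add_left (m : MonomialOrder (Fin n)) (t : Fin n →₀ ℕ) {a b : Fin n →₀ ℕ} (h : a ≺[m] b) :
    t + a ≺[m] t + b := by
  rw [map_add, map_add]
  exact (add_lt_add_iff_left _).mpr h

variable [ExpChar K p]

/-- **Every monomial is a `U`-combination of standard monomials** (division by the pivot powers:
`X_{ι(j)}^{q_j} = σ_j − Σ_{k ≠ ι(j)} c_{jk} X_k^{q_j}` with all terms on the right `≺_P`-smaller; well-founded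
induction on `≺_P`). [folklore] -/
private theorem monomial_mem_stdSpan (P : TriangularPresentation p U) (s : Fin n →₀ ℕ) :
    monomial s (1 : K) ∈ stdSpan P := by
  classical
  -- well-founded induction along the pivot weight order
  suffices h : ∀ d : (triOrder P).syn, ∀ s : Fin n →₀ ℕ, (triOrder P).toSyn s = d → monomial s (1 : K) ∈ stdSpan P from
    h _ s rfl
  intro d
  induction d using WellFoundedLT.induction with
  | ind d ih =>
    intro s hs
    by_cases hstd : IsTriStd P s
    · exact Submodule.subset_span ⟨s, hstd, rfl⟩
    · obtain ⟨j, hj⟩ : ∃ j, P.q j ≤ s (P.pivot j) := by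
        obtain ⟨j, hj⟩ := not_forall.mp hstd
        exact ⟨j, not_lt.mp hj⟩
      -- `s = t + q_j e_{ι(j)}`
      obtain ⟨t, rfl⟩ : ∃ t, s = t + Finsupp.single (P.pivot j) (P.q j) :=
        ⟨s - Finsupp.single (P.pivot j) (P.q j), by rw [tsub_add_cancel_of_le (Finsupp.single_le_iff.mpr hj)]⟩
      -- the division identity
      have key : monomial (t + Finsupp.single (P.pivot j) (P.q j)) (1 : K) = P.gen j * monomial t 1 -
          ∑ k ∈ Finset.univ.erase (P.pivot j), C (P.coef j k) * monomial (t + Finsupp.single k (P.q j)) 1 := by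
        rw [TriangularPresentation.gen, Finset.sum_mul, ← Finset.add_sum_erase _ _ (Finset.mem_univ (P.pivot j)),
          P.coef_pivot, C_1, one_mul]
        have hmul : ∀ k : Fin n, (X k ^ p ^ P.expo j : MvPolynomial (Fin n) K) * monomial t 1 =
            monomial (t + Finsupp.single k (P.q j)) 1 := by
          intro k
          rw [X_pow_eq_monomial, monomial_mul, one_mul, add_comm]
          rfl
        simp_rw [mul_assoc, hmul]
        rw [add_sub_cancel_right]
      rw [key]
      refine (stdSpan P).sub_mem ?_ ((stdSpan P).sum_mem fun k hk => ?_)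
      · -- `σ_j · X^t` with `X^t` smaller
        have htlt : t ≺[triOrder P] t + Finsupp.single (P.pivot j) (P.q j) := by
          refine toSyn_lt_add _ t ?_
          rw [Ne, Finsupp.single_eq_zero]
          exact Nat.pos_iff_ne_zero.mp (P.one_le_q j)
        have hmem : monomial t (1 : K) ∈ stdSpan P := ih _ (htlt.trans_eq hs) t rfl
        have := (stdSpan P).smul_mem ⟨P.gen j, P.gen_mem j⟩ hmem
        rwa [Subalgebra.smul_def, smul_eq_mul] at this
      · -- the other terms `c_{jk} X^{t + q_j e_k}`, smaller when present
        by_cases hc : P.coef j k = 0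
        · rw [hc, C_0, zero_mul]; exact (stdSpan P).zero_mem
        · have hk : k ≠ P.pivot j := (Finset.mem_erase.mp hk).1
          have hlt : t + Finsupp.single k (P.q j) ≺[triOrder P] t + Finsupp.single (P.pivot j) (P.q j) :=
            toSyn_add_lt_add_left _ t (toSyn_single_lt P j hk hc)
          have hmem : monomial (t + Finsupp.single k (P.q j)) (1 : K) ∈ stdSpan P := ih _ (hlt.trans_eq hs) _ rfl
          rw [← smul_eq_C_mul]
          exact smul_mem_stdSpan P _ hmem

/-- **`S = Σ_{b standard} U · X^b`** (division by the triangular system, quotients collected in `U = K[σ]`).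
[cite: Giraud1975, §1.6 (3)–(4) p.204] -/
theorem mem_stdSpan (P : TriangularPresentation p U) (f : MvPolynomial (Fin n) K) : f ∈ stdSpan P := by
  rw [f.as_sum]
  refine (stdSpan P).sum_mem fun s _ => ?_
  rw [← mul_one (coeff s f), ← smul_eq_mul, ← smul_monomial]
  exact smul_mem_stdSpan P _ (monomial_mem_stdSpan P s)

/-- **Expansion**: every `f ∈ S` is a finite sum `Σ_b u_b X^b` over standard exponents `b` with coefficients
`u_b ∈ U`. [cite: Giraud1975, §1.6 (3)–(4) p.204] -/
theorem exists_expansion (P : TriangularPresentation p U) (f : MvPolynomial (Fin n) K) :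
    ∃ l : (Fin n →₀ ℕ) →₀ U, (∀ b ∈ l.support, IsTriStd P b) ∧
      f = ∑ b ∈ l.support, (l b : MvPolynomial (Fin n) K) * monomial b 1 := by
  have h := mem_stdSpan P f
  rw [stdSpan, Finsupp.mem_span_image_iff_linearCombination] at h
  obtain ⟨l, hl, hlf⟩ := h
  refine ⟨l, fun b hb => hl hb, ?_⟩
  rw [← hlf, Finsupp.linearCombination_apply, Finsupp.sum]
  rfl

end Expansion

end Literature.AlgebraicGeometry.Resolution

end
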